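import Summits.BirchSwinnertonDyer.BirchSwinnertonDyer.Theorems.PrintCf2RamifiedOffTYZPartnerShaSelmerR1
import Summits.BirchSwinnertonDyer.BirchSwinnertonDyer.Theorems.PrintCf2RamifiedOffTYZPartnerShaSelmerR2Prime
import HarnessLib

/-!
# Crux `PrintCf2.RamifiedOffTYZOfFacts` (stmt-BirchSwinnertonDyer-20509), line `offtyz-v7`, LEAD cycle 24 (cruxlead-20509 g23), part 2/4:
# LOCAL TOOLS AT A PRIME `m ≡ 5 (mod 8)` AND THE CLASSES `l`, `m` OF THE `φ`-DESCENT ON R1 (`n = lm`, `l ≡ 1`, `m ≡ 5 (mod 8)`, `(l/m) = +1`)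

THEOREMS ONLY (no `def`, no named fact, no `sorry`), `--supports stmt-BirchSwinnertonDyer-20509`.  Same setting as part 1 (R1).  On R2 the
`φ`-Selmer group is `{1, 2, l, 2l}` (part 6 of cycle 21): there `2` is a class (`q ≡ 7 (mod 8)`) and `q` is killed by the `q`-adic obstruction
with `−4l²` a non-residue mod `q ≡ 3 (4)`.  On R1 BOTH mechanisms change: `m ≡ 5 (mod 8)` IS a class (the `2`-adic point is
`(1, 1, √(m(1 + 4l²)))`, `m(1+4l²) ≡ 5·5 ≡ 1 (mod 8)`), and the even classes `2, 2l, 2m, 2lm` are killed `m`-adically (part 3) — `2, 2l` because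
`2` is a non-residue mod `m ≡ 5 (8)` (`not_isSoluble_padic_diag_of_sq_mul`: `w² = A u⁴ + q²E₁ z⁴` with `A`, `E₁` non-residues), `2m, 2lm` because
`−l²` resp. `−1` is NOT A FOURTH POWER mod `m ≡ 5 (mod 8)` (`pow_four_ne_neg_one_of_emod_eight`: a fourth root of `−1` would contradict Fermat,
`(−1)^{(m−1)/4} = −1`; `not_isSoluble_padic_diag_of_dvd_both_of_forall`: `w² = q d₁u⁴ + q e₁z⁴` with `d₁x⁴ + e₁ ≢ 0` for all `x`) — the
square-level obstruction of cycle 21 part 4 (`−d₁e₁` a non-residue) does NOT fire here since `−4l²` IS a square mod `m ≡ 1 (4)`.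

* §13 `pow_four_ne_neg_one_of_emod_eight`, `pow_four_ne_neg_sq_of_emod_eight`, `not_isSoluble_padic_diag_of_sq_mul`,
  `not_isSoluble_padic_diag_of_dvd_both_of_forall`.
* §14 `isLocallySoluble_l_class_R1` (`w² = l u⁴ + 4lm² z⁴`), `isLocallySoluble_m_class_R1` (`w² = m u⁴ + 4ml² z⁴`) — everywhere locally soluble.
Beyond-print theorem: NO (a routine `2`-isogeny descent).  BSD is not proved by any of this; C⁺ (23431) and the crux stay OPEN.

References: [cite: SilvermanAEC2009, Prop. X.4.9, Example X.4.10, Prop. X.6.2(b)]; [cite: SilvermanTate2015, §3.6]; [cite: TianYuanZhang2017, §1 (A_n, φ_n)];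
tree: part 1 (`…PartnerShaSelmerR1`), cycle 21 parts 4–6 (`…PartnerSha{DiagonalQuartics,SelmerR2,SelmerR2Prime}`).
-/

noncomputable section

open scoped Classical

open WeierstrassCurve Literature.NumberTheory Literature.NumberTheory.EllipticCurves Literature.NumberTheory.DiophantineGeometry
  Literature.NumberTheory.DiophantineGeometry.LindMordellQuartics Literature.NumberTheory.EllipticCurves.TianYuanZhang2017

namespace Summit.BirchSwinnertonDyer.PrintCf2.PartnerSha

/-- A prime `≥ 5` is what remains after excluding `2` and `3`. [folklore] -/
private theorem five_le_of_prime_ne {p : ℕ} (hp : p.Prime) (h2 : p ≠ 2) (h3 : p ≠ 3) : 5 ≤ p := by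
  by_contra h
  interval_cases p <;> first | exact absurd hp (by decide) | omega

/-- Residues mod `3` of a prime `≠ 3`. [folklore] -/
private theorem mod_three_of_prime_ne_three {p : ℕ} (hp : p.Prime) (h3 : p ≠ 3) : p % 3 = 1 ∨ p % 3 = 2 := by
  have : p % 3 ≠ 0 := fun h0 => by
    have h := (Nat.dvd_prime hp).mp (Nat.dvd_of_mod_eq_zero h0)
    omega
  omega

/-! ## §13 Arithmetic and local tools at a prime `m ≡ 5 (mod 8)` -/

/-- **No fourth root of `−1` modulo a prime `m ≡ 5 (mod 8)`**: `t⁴ = −1` would give `t^{m−1} = (t⁴)^{(m−1)/4} = (−1)^{odd} = −1`,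
against Fermat. [folklore] -/
theorem pow_four_ne_neg_one_of_emod_eight {m : ℕ} [hmp : Fact m.Prime] (hm8 : m % 8 = 5) (t : ZMod m) : t ^ 4 ≠ -1 := by
  intro ht
  have ht0 : t ≠ 0 := by
    rintro rfl
    rw [zero_pow four_ne_zero] at ht
    exact one_ne_zero (neg_eq_zero.mp ht.symm)
  have hferm := ZMod.pow_card_sub_one_eq_one ht0
  obtain ⟨b, hb⟩ : ∃ b, m = 8 * b + 5 := ⟨m / 8, by omega⟩
  have hm1 : m - 1 = 4 * (2 * b + 1) := by omega
  rw [hm1, pow_mul, ht, Odd.neg_one_pow ⟨b, rfl⟩] at hferm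
  have h2 : (2 : ZMod m) = 0 := by linear_combination -hferm
  have h2' : ((2 : ℕ) : ZMod m) = 0 := by exact_mod_cast h2
  rw [ZMod.natCast_eq_zero_iff] at h2'
  have := Nat.le_of_dvd two_pos h2'
  omega

/-- **`−c²` is not a fourth power modulo a prime `m ≡ 5 (mod 8)` when `c ≠ 0` is a square**: `x⁴ = −c²`, `c = s²` gives `(x/s)⁴ = −1`.
[folklore] -/
theorem pow_four_ne_neg_sq_of_emod_eight {m : ℕ} [hmp : Fact m.Prime] (hm8 : m % 8 = 5) {c : ZMod m} (hc0 : c ≠ 0)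
    (hc : IsSquare c) (x : ZMod m) : x ^ 4 ≠ -c ^ 2 := by
  obtain ⟨s, hs⟩ := hc
  have hs0 : s ≠ 0 := by rintro rfl; rw [mul_zero] at hs; exact hc0 hs
  intro hx
  apply pow_four_ne_neg_one_of_emod_eight hm8 (x * s⁻¹)
  have hs4 : (s * s) ^ 2 = s ^ 4 := by ring
  rw [mul_pow, hx, hs, hs4, inv_pow, neg_mul, mul_inv_cancel₀ (pow_ne_zero 4 hs0)]

/-- **The `q`-adic obstruction for `w² = A u⁴ + q² E₁ z⁴` with `A` and `E₁` non-residues mod `q`**: a primitive `ℤ_q`-point has either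
`w² ≡ A u⁴` with `u` a unit (or the chart `u = 1`), exhibiting `A` as a square mod `q`, or `q ∣ u`, then `q ∣ w` and `(w/q)² ≡ E₁`,
exhibiting `E₁` as a square. (The classes `2`, `2l` of the `φ`-descent on R1, at `q = m ≡ 5 (8)`.) [cite: SilvermanAEC2009, Example X.4.10 (method)] -/
theorem not_isSoluble_padic_diag_of_sq_mul {q : ℕ} [hq : Fact q.Prime] {A E₁ : ℤ}
    (hA : ¬ IsSquare ((A : ℤ) : ZMod q)) (hE : ¬ IsSquare ((E₁ : ℤ) : ZMod q)) :
    ¬ ((⟨A, 0, 0, 0, (q : ℤ) ^ 2 * E₁⟩ : BinaryQuartic ℤ).map (Int.castRingHom ℚ_[q])).IsSoluble := by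
  intro hsol
  rw [← BinaryQuartic.map_intCast_map_coe, BinaryQuartic.isSoluble_map_coe_iff] at hsol
  have hev : ∀ x y : ℤ_[q], ((⟨A, 0, 0, 0, (q : ℤ) ^ 2 * E₁⟩ : BinaryQuartic ℤ).map (Int.castRingHom ℤ_[q])).eval x y
      = (A : ℤ_[q]) * x ^ 4 + (q : ℤ_[q]) ^ 2 * (E₁ : ℤ_[q]) * y ^ 4 := fun x y => by
    rw [eval_map_diag]; simp
  have hq0 : (q : ℤ_[q]) ≠ 0 := by exact_mod_cast hq.out.ne_zero
  have hqbar : PadicInt.toZMod (q : ℤ_[q]) = 0 := by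
    rw [map_natCast, ZMod.natCast_self]
  rcases hsol with ⟨t, z, hz⟩ | ⟨t, z, hz⟩
  · -- chart `(1, t)`: `z² = A + q²E₁t⁴ ≡ A`
    rw [hev, one_pow, mul_one] at hz
    have h0 := congrArg PadicInt.toZMod hz
    simp only [map_add, map_mul, map_pow, map_intCast, hqbar] at h0
    apply hA
    exact ⟨PadicInt.toZMod z, by rw [← sq]; linear_combination -h0⟩
  · -- chart `(t, 1)`: `z² = A t⁴ + q²E₁`
    rw [hev, one_pow, mul_one] at hz
    by_cases ht : PadicInt.toZMod t = 0
    · -- `q ∣ t`: then `q ∣ z` and `(z/q)² ≡ E₁`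
      obtain ⟨w, hw⟩ := (BinaryQuartic.toZMod_eq_zero_iff t).mp ht
      rw [hw] at hz
      have hzbar : PadicInt.toZMod z = 0 := by
        have := congrArg PadicInt.toZMod hz
        rw [map_pow] at this
        simp only [map_add, map_mul, map_pow, map_intCast, hqbar, zero_pow two_ne_zero, zero_pow four_ne_zero,
          mul_zero, zero_mul, zero_add] at this
        exact pow_eq_zero_iff two_ne_zero |>.mp this
      obtain ⟨z₁, hz₁⟩ := (BinaryQuartic.toZMod_eq_zero_iff z).mp hzbar
      rw [hz₁] at hz
      have hq2 : (q : ℤ_[q]) ^ 2 ≠ 0 := pow_ne_zero 2 hq0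
      have h1 : z₁ ^ 2 = (A : ℤ_[q]) * (q : ℤ_[q]) ^ 2 * w ^ 4 + (E₁ : ℤ_[q]) :=
        mul_left_cancel₀ hq2 (by linear_combination hz)
      have h0 := congrArg PadicInt.toZMod h1
      simp only [map_add, map_mul, map_pow, map_intCast, hqbar] at h0
      apply hE
      exact ⟨PadicInt.toZMod z₁, by rw [← sq]; linear_combination -h0⟩
    · -- `t` a unit: `A ≡ (z/t²)²`
      have h0 := congrArg PadicInt.toZMod hz
      simp only [map_add, map_mul, map_pow, map_intCast, hqbar] at h0
      apply hA
      refine ⟨PadicInt.toZMod z * (PadicInt.toZMod t ^ 2)⁻¹, ?_⟩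
      have ht4 : PadicInt.toZMod t ^ 4 ≠ 0 := pow_ne_zero 4 ht
      field_simp
      linear_combination -h0

/-- **The `q`-adic obstruction for doubly `q`-divisible diagonal forms at the FOURTH-POWER level**: if `q ∤ d₁` and
`d₁ x⁴ + e₁ ≢ 0 (mod q)` for every `x`, then `w² = q d₁ u⁴ + q e₁ z⁴` has no `ℚ_q`-point (a primitive integral point has `q ∣ w`, hence
`d₁ u⁴ + e₁ z⁴ ≡ 0` with `u` or `z` a unit).  Sharper than part 4's `not_isSoluble_padic_diag_of_dvd_both` (which needs `−d₁e₁` a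
NON-RESIDUE): on R1 `−d₁e₁ = −4l²` IS a square mod `m ≡ 1 (4)`, but `−l²`, `−1` are not fourth powers mod `m ≡ 5 (8)`.
[cite: SilvermanAEC2009, Example X.4.10 (the argument)] -/
theorem not_isSoluble_padic_diag_of_dvd_both_of_forall {q : ℕ} [hq : Fact q.Prime] {d₁ e₁ : ℤ}
    (hd : ¬ (q : ℤ) ∣ d₁) (h : ∀ x : ZMod q, ((d₁ : ℤ) : ZMod q) * x ^ 4 + e₁ ≠ 0) :
    ¬ ((⟨q * d₁, 0, 0, 0, q * e₁⟩ : BinaryQuartic ℤ).map (Int.castRingHom ℚ_[q])).IsSoluble := by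
  intro hsol
  rw [← BinaryQuartic.map_intCast_map_coe, BinaryQuartic.isSoluble_map_coe_iff] at hsol
  have hev : ∀ x y : ℤ_[q], ((⟨q * d₁, 0, 0, 0, q * e₁⟩ : BinaryQuartic ℤ).map (Int.castRingHom ℤ_[q])).eval x y
      = (q : ℤ_[q]) * ((d₁ : ℤ_[q]) * x ^ 4 + (e₁ : ℤ_[q]) * y ^ 4) := fun x y => by
    rw [eval_map_diag]; simp; ring
  have hq0 : (q : ℤ_[q]) ≠ 0 := by exact_mod_cast hq.out.ne_zero
  have hqbar : PadicInt.toZMod (q : ℤ_[q]) = 0 := by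
    rw [map_natCast, ZMod.natCast_self]
  -- common core: from `z² = q·m` with `m ∈ ℤ_q` deduce `toZMod m = 0`
  have core : ∀ z c : ℤ_[q], z ^ 2 = (q : ℤ_[q]) * c → PadicInt.toZMod c = 0 := by
    intro z c hzc
    have hz : PadicInt.toZMod z = 0 := by
      have := congrArg PadicInt.toZMod hzc
      rw [map_pow, map_mul, hqbar, zero_mul] at this
      exact pow_eq_zero_iff two_ne_zero |>.mp this
    obtain ⟨w, hw⟩ := (BinaryQuartic.toZMod_eq_zero_iff z).mp hz
    rw [hw] at hzc
    have hc : c = (q : ℤ_[q]) * w ^ 2 := mul_left_cancel₀ hq0 (by linear_combination -hzc)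
    rw [hc, map_mul, hqbar, zero_mul]
  rcases hsol with ⟨t, z, hz⟩ | ⟨t, z, hz⟩
  · -- chart `(1, t)`: `d₁ + e₁ t̄⁴ = 0`
    rw [hev, one_pow, mul_one] at hz
    have h0 := core z _ hz
    simp only [map_add, map_mul, map_pow, map_intCast] at h0
    by_cases ht : PadicInt.toZMod t = 0
    · rw [ht, zero_pow four_ne_zero, mul_zero, add_zero] at h0
      exact hd ((ZMod.intCast_zmod_eq_zero_iff_dvd d₁ q).mp h0)
    · apply h (PadicInt.toZMod t)⁻¹
      have ht4 : PadicInt.toZMod t ^ 4 ≠ 0 := pow_ne_zero 4 ht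
      field_simp
      linear_combination h0
  · -- chart `(t, 1)`: `d₁ t̄⁴ + e₁ = 0`
    rw [hev, one_pow, mul_one] at hz
    have h0 := core z _ hz
    simp only [map_add, map_mul, map_pow, map_intCast] at h0
    exact h (PadicInt.toZMod t) h0

/-! ## §14 `Sel^{(φ)}(E_{lm} → A_{lm})` on R1: `S(0, 4l²m²) = {1, l, m, lm}`, `dim S'(0, −l²m²) = 2` -/

section R1'

variable {l m : ℕ} [hlp : Fact l.Prime] [hmp : Fact m.Prime]

/-- **The class `l` of `Sel^{(φ)}` on R1**: `w² = l u⁴ + 4lm² z⁴` is everywhere locally soluble — at `l` the exact zero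
`u = (1 + i)√m ∈ ℤ_l` (`u⁴ = −4m²`; `i = √−1`, `√m ∈ ℤ_l` since `l ≡ 1 (mod 8)`, `(m/l) = 1`), at `m` and `2` the point `(1, 0, √l)`,
at `3` a unit square value, elsewhere good reduction (verbatim the R2 argument, `q ↦ m`). [cite: SilvermanAEC2009, Prop. X.4.9, Example X.4.10 (method)] -/
theorem isLocallySoluble_l_class_R1 (hl8 : l % 8 = 1) (hm8 : m % 8 = 5)
    (hlm : IsSquare ((l : ℤ) : ZMod m)) (hml : IsSquare ((m : ℤ) : ZMod l)) :
    (⟨l, 0, 0, 0, 4 * l * (m : ℤ) ^ 2⟩ : BinaryQuartic ℤ).IsLocallySoluble := by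
  have hl := hlp.out
  have hm := hmp.out
  have hlm_ne : l ≠ m := by rintro rfl; omega
  have hl2 : l ≠ 2 := by rintro rfl; omega
  have hl3 : l ≠ 3 := by rintro rfl; omega
  have hm2 : m ≠ 2 := by rintro rfl; omega
  have hm3 : m ≠ 3 := by rintro rfl; omega
  have hlnm : ¬ (l : ℤ) ∣ m := fun h =>
    hlm_ne ((Nat.prime_dvd_prime_iff_eq hl hm).mp (by exact_mod_cast h))
  have hmnl : ¬ (m : ℤ) ∣ l := fun h =>
    hlm_ne ((Nat.prime_dvd_prime_iff_eq hm hl).mp (by exact_mod_cast h)).symm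
  refine ⟨?_, fun p hp => ?_⟩
  · have := isSoluble_real_twoIsogenyQuartic_of_pos (d := l) (by exact_mod_cast hl.pos) 0 (4 * l * (m : ℤ) ^ 2)
    rwa [twoIsogenyQuartic_zero] at this
  · have hpP := hp.out
    by_cases hpl : p = l
    · -- the exact zero `((1 + ι)s, 1, 0)`
      subst hpl
      obtain ⟨ι, hι⟩ := LocalFields.padicInt_exists_sq_eq_neg_one (p := p) (by omega)
      obtain ⟨s, hs⟩ := exists_sq_eq_intCast_of_isSquare hl2 hlnm hml
      refine isSoluble_padic_diag_of_point (x := (1 + ι) * s) (y := 1) (z := 0) (Or.inr one_ne_zero) ?_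
      have h4 : ((1 + ι) * s) ^ 4 = -4 * ((m : ℤ) : ℤ_[p]) ^ 2 := by
        have : ((1 + ι) * s) ^ 4 = ((1 + ι) ^ 2) ^ 2 * (s ^ 2) ^ 2 := by ring
        rw [this, hs, show (1 + ι) ^ 2 = 1 + 2 * ι + ι ^ 2 by ring, hι]
        ring_nf
        rw [hι]; ring
      rw [h4]; push_cast; ring
    by_cases hpm : p = m
    · subst hpm
      obtain ⟨r, hr⟩ := exists_sq_eq_intCast_of_isSquare hm2 hmnl hlm
      exact isSoluble_padic_diag_of_point (x := 1) (y := 0) (z := r) (Or.inl one_ne_zero)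
        (by rw [hr]; push_cast; ring)
    by_cases hp2 : p = 2
    · subst hp2
      obtain ⟨r, hr⟩ := exists_sq_eq_two_of_emod_eight (c := l) (by exact_mod_cast (show (l : ℤ) % 8 = 1 by omega))
      exact isSoluble_padic_diag_of_point (x := 1) (y := 0) (z := r) (Or.inl one_ne_zero)
        (by rw [hr]; push_cast; ring)
    by_cases hp3 : p = 3
    · subst hp3
      have hm3' := sq_eq_one_zmod_three (mod_three_of_prime_ne_three hm hm3)
      rcases mod_three_of_prime_ne_three hl hl3 with h1 | h2
      · -- `(0, 1, √(4lm²))`, `4lm² ≡ l ≡ 1 (mod 3)`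
        obtain ⟨r, hr⟩ := exists_sq_eq_intCast (q := 3) (by norm_num) (c := 4 * l * (m : ℤ) ^ 2) (w := 1)
          (by norm_num) (by
            refine (ZMod.intCast_zmod_eq_zero_iff_dvd _ 3).mp ?_
            have hl' : (l : ZMod 3) = 1 := by rw [← ZMod.natCast_mod l 3, h1]; rfl
            push_cast; rw [hm3', hl']; reduce_mod_char)
        exact isSoluble_padic_diag_of_point (x := 0) (y := 1) (z := r) (Or.inr one_ne_zero)
          (by rw [hr]; push_cast; ring)
      · -- `(1, 1, √(l + 4lm²))`, `≡ 2 + 2 ≡ 1 (mod 3)`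
        obtain ⟨r, hr⟩ := exists_sq_eq_intCast (q := 3) (by norm_num) (c := l + 4 * l * (m : ℤ) ^ 2) (w := 1)
          (by norm_num) (by
            refine (ZMod.intCast_zmod_eq_zero_iff_dvd _ 3).mp ?_
            have hl' : (l : ZMod 3) = 2 := by rw [← ZMod.natCast_mod l 3, h2]; rfl
            push_cast; rw [hm3', hl']; reduce_mod_char)
        exact isSoluble_padic_diag_of_point (x := 1) (y := 1) (z := r) (Or.inl one_ne_zero)
          (by rw [hr]; push_cast; ring)
    · have hp5 := five_le_of_prime_ne hpP hp2 hp3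
      have hpi : Prime (p : ℤ) := Nat.prime_iff_prime_int.mp hpP
      have hpnl : ¬ (p : ℤ) ∣ l := fun h => hpl ((Nat.prime_dvd_prime_iff_eq hpP hl).mp (by exact_mod_cast h))
      have hpnm : ¬ (p : ℤ) ∣ m := fun h => hpm ((Nat.prime_dvd_prime_iff_eq hpP hm).mp (by exact_mod_cast h))
      have hpn2 : ¬ (p : ℤ) ∣ 4 := fun h => by
        have : (p : ℤ) ∣ 2 ^ 2 := by norm_num; exact h
        have h2 := Int.le_of_dvd (by norm_num) (hpi.dvd_of_dvd_pow this)
        omega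
      refine isSoluble_padic_diag_of_five_le hp5 hpnl ?_
      intro h
      rcases hpi.dvd_or_dvd h with h1 | h1
      · rcases hpi.dvd_or_dvd h1 with h3 | h3
        · exact hpn2 h3
        · exact hpnl h3
      · exact hpnm (hpi.dvd_of_dvd_pow h1)

/-- **The class `m` of `Sel^{(φ)}` on R1** (no R2 analogue: there the second prime `q` is NOT a class): `w² = m u⁴ + 4ml² z⁴` is
everywhere locally soluble — at `m` the exact zero `u = (1 + i)√l ∈ ℤ_m` (`m ≡ 1 (mod 4)`, `(l/m) = 1`), at `l` the point `(1, 0, √m)`,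
at `2` the point `(1, 1, √(m(1 + 4l²)))` (`m(1 + 4l²) ≡ 5 · 5 ≡ 1 (mod 8)`), at `3` a unit square value, elsewhere good reduction.
[cite: SilvermanAEC2009, Prop. X.4.9, Example X.4.10 (method)] -/
theorem isLocallySoluble_m_class_R1 (hl8 : l % 8 = 1) (hm8 : m % 8 = 5)
    (hlm : IsSquare ((l : ℤ) : ZMod m)) (hml : IsSquare ((m : ℤ) : ZMod l)) :
    (⟨m, 0, 0, 0, 4 * m * (l : ℤ) ^ 2⟩ : BinaryQuartic ℤ).IsLocallySoluble := by
  have hl := hlp.out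
  have hm := hmp.out
  have hlm_ne : l ≠ m := by rintro rfl; omega
  have hl2 : l ≠ 2 := by rintro rfl; omega
  have hl3 : l ≠ 3 := by rintro rfl; omega
  have hm2 : m ≠ 2 := by rintro rfl; omega
  have hm3 : m ≠ 3 := by rintro rfl; omega
  have hlnm : ¬ (l : ℤ) ∣ m := fun h =>
    hlm_ne ((Nat.prime_dvd_prime_iff_eq hl hm).mp (by exact_mod_cast h))
  have hmnl : ¬ (m : ℤ) ∣ l := fun h =>
    hlm_ne ((Nat.prime_dvd_prime_iff_eq hm hl).mp (by exact_mod_cast h)).symm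
  refine ⟨?_, fun p hp => ?_⟩
  · have := isSoluble_real_twoIsogenyQuartic_of_pos (d := m) (by exact_mod_cast hm.pos) 0 (4 * m * (l : ℤ) ^ 2)
    rwa [twoIsogenyQuartic_zero] at this
  · have hpP := hp.out
    by_cases hpm : p = m
    · -- the exact zero `((1 + ι)s, 1, 0)`, `s² = l`
      subst hpm
      obtain ⟨ι, hι⟩ := LocalFields.padicInt_exists_sq_eq_neg_one (p := p) (by omega)
      obtain ⟨s, hs⟩ := exists_sq_eq_intCast_of_isSquare hm2 hmnl hlm
      refine isSoluble_padic_diag_of_point (x := (1 + ι) * s) (y := 1) (z := 0) (Or.inr one_ne_zero) ?_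
      have h4 : ((1 + ι) * s) ^ 4 = -4 * ((l : ℤ) : ℤ_[p]) ^ 2 := by
        have : ((1 + ι) * s) ^ 4 = ((1 + ι) ^ 2) ^ 2 * (s ^ 2) ^ 2 := by ring
        rw [this, hs, show (1 + ι) ^ 2 = 1 + 2 * ι + ι ^ 2 by ring, hι]
        ring_nf
        rw [hι]; ring
      rw [h4]; push_cast; ring
    by_cases hpl : p = l
    · subst hpl
      obtain ⟨r, hr⟩ := exists_sq_eq_intCast_of_isSquare hl2 hlnm hml
      exact isSoluble_padic_diag_of_point (x := 1) (y := 0) (z := r) (Or.inl one_ne_zero)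
        (by rw [hr]; push_cast; ring)
    by_cases hp2 : p = 2
    · subst hp2
      -- `l = 8a + 1`, `m = 8b + 5`, `m + 4ml² = m(1 + 4l²) = 1 + 8K`
      obtain ⟨a, ha⟩ : ∃ a, l = 8 * a + 1 := ⟨l / 8, by omega⟩
      obtain ⟨b, hb⟩ : ∃ b, m = 8 * b + 5 := ⟨m / 8, by omega⟩
      set K : ℤ := 256 * (a : ℤ) ^ 2 * b + 64 * a * b + 5 * b + 160 * (a : ℤ) ^ 2 + 40 * a + 3 with hK
      have key : (m : ℤ) + 4 * m * (l : ℤ) ^ 2 = 1 + 8 * K := by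
        have hlZ : (l : ℤ) = 8 * a + 1 := by exact_mod_cast ha
        have hmZ : (m : ℤ) = 8 * b + 5 := by exact_mod_cast hb
        rw [hK, hlZ, hmZ]; ring
      have h8 : ((m : ℤ) + 4 * m * (l : ℤ) ^ 2) % 8 = 1 := by
        rw [key, Int.add_mul_emod_self_left]; norm_num
      obtain ⟨r, hr⟩ := exists_sq_eq_two_of_emod_eight h8
      exact isSoluble_padic_diag_of_point (x := 1) (y := 1) (z := r) (Or.inl one_ne_zero)
        (by rw [hr]; push_cast; ring)
    by_cases hp3 : p = 3
    · subst hp3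
      have hl3' := sq_eq_one_zmod_three (mod_three_of_prime_ne_three hl hl3)
      rcases mod_three_of_prime_ne_three hm hm3 with h1 | h2
      · -- `(0, 1, √(4ml²))`, `4ml² ≡ m ≡ 1 (mod 3)`
        obtain ⟨r, hr⟩ := exists_sq_eq_intCast (q := 3) (by norm_num) (c := 4 * m * (l : ℤ) ^ 2) (w := 1)
          (by norm_num) (by
            refine (ZMod.intCast_zmod_eq_zero_iff_dvd _ 3).mp ?_
            have hm' : (m : ZMod 3) = 1 := by rw [← ZMod.natCast_mod m 3, h1]; rfl
            push_cast; rw [hl3', hm']; reduce_mod_char)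
        exact isSoluble_padic_diag_of_point (x := 0) (y := 1) (z := r) (Or.inr one_ne_zero)
          (by rw [hr]; push_cast; ring)
      · -- `(1, 1, √(m + 4ml²))`, `≡ 2 + 2 ≡ 1 (mod 3)`
        obtain ⟨r, hr⟩ := exists_sq_eq_intCast (q := 3) (by norm_num) (c := m + 4 * m * (l : ℤ) ^ 2) (w := 1)
          (by norm_num) (by
            refine (ZMod.intCast_zmod_eq_zero_iff_dvd _ 3).mp ?_
            have hm' : (m : ZMod 3) = 2 := by rw [← ZMod.natCast_mod m 3, h2]; rfl
            push_cast; rw [hl3', hm']; reduce_mod_char)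
        exact isSoluble_padic_diag_of_point (x := 1) (y := 1) (z := r) (Or.inl one_ne_zero)
          (by rw [hr]; push_cast; ring)
    · have hp5 := five_le_of_prime_ne hpP hp2 hp3
      have hpi : Prime (p : ℤ) := Nat.prime_iff_prime_int.mp hpP
      have hpnl : ¬ (p : ℤ) ∣ l := fun h => hpl ((Nat.prime_dvd_prime_iff_eq hpP hl).mp (by exact_mod_cast h))
      have hpnm : ¬ (p : ℤ) ∣ m := fun h => hpm ((Nat.prime_dvd_prime_iff_eq hpP hm).mp (by exact_mod_cast h))
      have hpn2 : ¬ (p : ℤ) ∣ 4 := fun h => by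
        have : (p : ℤ) ∣ 2 ^ 2 := by norm_num; exact h
        have h2 := Int.le_of_dvd (by norm_num) (hpi.dvd_of_dvd_pow this)
        omega
      refine isSoluble_padic_diag_of_five_le hp5 hpnm ?_
      intro h
      rcases hpi.dvd_or_dvd h with h1 | h1
      · rcases hpi.dvd_or_dvd h1 with h3 | h3
        · exact hpn2 h3
        · exact hpnm h3
      · exact hpnl (hpi.dvd_of_dvd_pow h1)

end R1'

end Summit.BirchSwinnertonDyer.PrintCf2.PartnerSha

end
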